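import Summits.AnomalousDissipation.AnomalousDissipation.Theorems.NeutralTaylorWavesTaylorWaveQuasiSteadyHierarchyEnergy

/-!
# The formal momentum identity of the ε-free hierarchy (line `windfibred`, rev 3)
# (crux stmt-AnomalousDissipation-16293, `NeutralTaylorWaves.TaylorWaveQuasiSteady`)

**Theorem (`stub_hierarchyWMomentum`).**  For smooth `G`, `f`, `P_a`, `Q_a` with `∫_{T³} f = 0` and a formal
two-scale divergence vanishing to order `N + 1` (`divCoeff … s ≡ 0` for `s ≤ N + 1`), EVERY coefficient profile of
the ε-free steady residual has zero total mean: `∫_{T⁴} hierarchyCoeff j G f N P Q c s = 0` for all `s : ℕ` — the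
formal, exact counterpart of momentum conservation (a necessary condition on the data `P_a, Q_a, c_a` of the open
core `stub_hierarchyW`, order by order).

Proof.  Every viscous, pressure and drift term of `hierarchyCoeff` is a slow derivative `∂_{xᵢ}(·)` or a weighted
fast derivative `kᵢ(x) ∂_θ(·) = ∂_θ(kᵢ(x) ·)` of a smooth profile, hence has zero integral over `T⁴`
(`Torus.integral_partialDeriv_eq_zero_holds`); the force `[s = 1] f ∘ slow` integrates to `∫_{T³} f = 0` (Fubini
over the fast fibre).  The convection terms are rewritten POINTWISE by the Leibniz rule,
`∑ₗ (P_a)ₗ ∂ₗ P_b = ∑ₗ ∂ₗ((P_a)ₗ P_b) − (div_x P_a) P_b`, `∑ₗ (P_a)ₗ kₗ∂_θ P_b = ∂_θ((P_a·k) P_b) − (k·∂_θP_a) P_b`,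
and after summation over `a` the non-derivative parts multiplying `P_b` add up to `divCoeff … (s − b) · P_b = 0`
(`sum_div_indicator_eq_zero`), so the convection sum, too, is a sum of total derivatives (`conv_eq_totalDeriv`).
Registered as the tools sub-stub `stub_hierarchyWMomentum` (last theorem). [folklore]
-/

-- `Summit.<Summit>.<Problem>` is the tree's mandated summit-side namespace (CONVENTIONS §2); for this
-- single-conjunct summit the two coincide, so the duplicate is deliberate.
set_option linter.dupNamespace false

noncomputable section

open scoped BigOperators InnerProductSpace
open MeasureTheory
open Literature.Analysis.FunctionSpaces Literature.Analysis.FunctionSpaces.Torus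

namespace Summit.AnomalousDissipation.AnomalousDissipation.Theorems.TaylorWaveQuasiSteady.Momentum

open Summit.AnomalousDissipation.AnomalousDissipation.Theorems.TaylorWaveQuasiSteady

variable {F : Type*} [NormedAddCommGroup F] [NormedSpace ℝ F]

/-! ## §1 Integrable profiles of zero mean: closure properties -/

/-- Sums of integrable zero-mean profiles are integrable of zero mean. [folklore] -/
theorem nm_add {u v : UnitAddTorus (Fin 4) → F} (hu : Integrable u ∧ ∫ y, u y = 0)
    (hv : Integrable v ∧ ∫ y, v y = 0) : Integrable (fun y => u y + v y) ∧ ∫ y, (u y + v y) = 0 :=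
  ⟨hu.1.add hv.1, by rw [integral_add hu.1 hv.1, hu.2, hv.2, add_zero]⟩

/-- Differences of integrable zero-mean profiles are integrable of zero mean. [folklore] -/
theorem nm_sub {u v : UnitAddTorus (Fin 4) → F} (hu : Integrable u ∧ ∫ y, u y = 0)
    (hv : Integrable v ∧ ∫ y, v y = 0) : Integrable (fun y => u y - v y) ∧ ∫ y, (u y - v y) = 0 :=
  ⟨hu.1.sub hv.1, by rw [integral_sub hu.1 hv.1, hu.2, hv.2, sub_zero]⟩

/-- Constant multiples of integrable zero-mean profiles are integrable of zero mean. [folklore] -/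
theorem nm_smul (r : ℝ) {u : UnitAddTorus (Fin 4) → F} (hu : Integrable u ∧ ∫ y, u y = 0) :
    Integrable (fun y => r • u y) ∧ ∫ y, r • u y = 0 :=
  ⟨hu.1.smul r, by rw [integral_smul, hu.2, smul_zero]⟩

/-- A zero-mean real profile times a constant vector is integrable of zero mean. [folklore] -/
theorem nm_smul_const [CompleteSpace F] {u : UnitAddTorus (Fin 4) → ℝ} (hu : Integrable u ∧ ∫ y, u y = 0)
    (v : F) : Integrable (fun y => u y • v) ∧ ∫ y, u y • v = 0 :=
  ⟨hu.1.smul_const v, by rw [integral_smul_const, hu.2, zero_smul]⟩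

/-- Indicator-weighted zero-mean profiles are integrable of zero mean. [folklore] -/
theorem nm_ite (p : Prop) [Decidable p] {u : UnitAddTorus (Fin 4) → F} (hu : Integrable u ∧ ∫ y, u y = 0) :
    Integrable (fun y => if p then u y else 0) ∧ ∫ y, (if p then u y else 0) = 0 := by
  by_cases hp : p
  · simp only [if_pos hp]
    exact hu
  · simp only [if_neg hp]
    exact ⟨integrable_const (0 : F), integral_zero _ _⟩

/-- Finite sums of integrable zero-mean profiles are integrable of zero mean. [folklore] -/
theorem nm_sum {ι : Type*} (s : Finset ι) {u : ι → UnitAddTorus (Fin 4) → F}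
    (hu : ∀ i ∈ s, Integrable (u i) ∧ ∫ y, u i y = 0) :
    Integrable (fun y => ∑ i ∈ s, u i y) ∧ ∫ y, (∑ i ∈ s, u i y) = 0 :=
  ⟨integrable_finsetSum s fun i hi => (hu i hi).1, by
    rw [integral_finsetSum s fun i hi => (hu i hi).1]
    exact Finset.sum_eq_zero fun i hi => (hu i hi).2⟩

/-! ## §2 Total derivatives have zero mean -/

/-- `∫_{T⁴} ∂ₘ Φ = 0` for a smooth profile (no boundary). [folklore] -/
theorem nm_partialDeriv {Φ : UnitAddTorus (Fin 4) → F} (hΦ : IsSmooth Φ) (m : Fin 4) :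
    Integrable (fun y => partialDeriv m Φ y) ∧ ∫ y, partialDeriv m Φ y = 0 :=
  ⟨(hΦ.partialDeriv m).integrable, integral_partialDeriv_eq_zero_holds hΦ m⟩

/-- `∫_{T⁴} ∂_{xᵢ} Φ = 0` for a smooth profile. [folklore] -/
theorem nm_sDeriv {Φ : UnitAddTorus (Fin 4) → F} (hΦ : IsSmooth Φ) (i : Fin 3) :
    Integrable (fun y => sDeriv i Φ y) ∧ ∫ y, sDeriv i Φ y = 0 :=
  nm_partialDeriv hΦ i.castSucc

/-- The weighted fast derivative is a total fast derivative: `kᵢ(x) ∂_θ Φ = ∂_θ (kᵢ(x) Φ)`. [folklore] -/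
theorem fDeriv_eq_partialDeriv_last (j : Fin 3 → ℤ) {G : UnitAddTorus (Fin 3) → ℝ} (hG : IsSmooth G) (i : Fin 3)
    {Φ : UnitAddTorus (Fin 4) → F} (hΦ : IsSmooth Φ) (y : UnitAddTorus (Fin 4)) :
    fDeriv j G i Φ y = partialDeriv (Fin.last 3) (fun z => phaseGrad j G i (slow z) • Φ z) y := by
  rw [partialDeriv_smul ((Energy.isSmooth_phaseGrad_slow j hG i).isContDiff (by simp)) (hΦ.isContDiff (by simp)),
    Energy.partialDeriv_last_comp_slow (fun x => phaseGrad j G i x) y, zero_smul, add_zero]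
  rfl

/-- `∫_{T⁴} kᵢ(x) ∂_θ Φ = 0` for a smooth profile. [folklore] -/
theorem nm_fDeriv (j : Fin 3 → ℤ) {G : UnitAddTorus (Fin 3) → ℝ} (hG : IsSmooth G) (i : Fin 3)
    {Φ : UnitAddTorus (Fin 4) → F} (hΦ : IsSmooth Φ) :
    Integrable (fun y => fDeriv j G i Φ y) ∧ ∫ y, fDeriv j G i Φ y = 0 := by
  have h : (fun y => fDeriv j G i Φ y) = fun y => partialDeriv (Fin.last 3) (fun z => phaseGrad j G i (slow z) • Φ z) y :=
    funext fun y => fDeriv_eq_partialDeriv_last j hG i hΦ y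
  rw [h]
  exact nm_partialDeriv ((Energy.isSmooth_phaseGrad_slow j hG i).smul' hΦ) (Fin.last 3)

/-- A vector of `ℝ³` in the standard basis: `toLp 2 g = ∑ᵢ gᵢ eᵢ`. [folklore] -/
theorem toLp_eq_sum_smul_single (g : Fin 3 → ℝ) :
    (WithLp.toLp 2 g : EuclideanSpace ℝ (Fin 3)) = ∑ i : Fin 3, g i • EuclideanSpace.single i (1 : ℝ) := by
  have h := (EuclideanSpace.basisFun (Fin 3) ℝ).sum_repr (WithLp.toLp 2 g)
  simp only [EuclideanSpace.basisFun_repr, EuclideanSpace.basisFun_apply] at h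
  exact h.symm

/-- A vector profile whose coordinates have zero mean has zero mean. [folklore] -/
theorem nm_toLp {g : Fin 3 → UnitAddTorus (Fin 4) → ℝ} (hg : ∀ i, Integrable (g i) ∧ ∫ y, g i y = 0) :
    Integrable (fun y => (WithLp.toLp 2 (fun i => g i y) : EuclideanSpace ℝ (Fin 3))) ∧
      ∫ y, (WithLp.toLp 2 (fun i => g i y) : EuclideanSpace ℝ (Fin 3)) = 0 := by
  have h : (fun y => (WithLp.toLp 2 (fun i => g i y) : EuclideanSpace ℝ (Fin 3))) =
      fun y => ∑ i : Fin 3, g i y • EuclideanSpace.single i (1 : ℝ) :=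
    funext fun y => toLp_eq_sum_smul_single _
  rw [h]
  exact nm_sum Finset.univ fun i _ => nm_smul_const (hg i) _

/-- **Fubini over the fast fibre for slow vector functions**: `∫_{T⁴} g(slow y) dy = ∫_{T³} g`. [folklore] -/
theorem integral_comp_slow [CompleteSpace F] {g : UnitAddTorus (Fin 3) → F} (hg : Continuous g) :
    ∫ y : UnitAddTorus (Fin 4), g (slow y) = ∫ x, g x := by
  have hslowc : Continuous (slow : UnitAddTorus (Fin 4) → UnitAddTorus (Fin 3)) :=
    continuous_pi fun l => continuous_apply _
  rw [DissipationLaw.integral_eq_integral_integral_snoc (Φ := fun y : UnitAddTorus (Fin 4) => g (slow y)) (hg.comp hslowc)]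
  have hsl : ∀ (x : UnitAddTorus (Fin 3)) (s : UnitAddCircle),
      slow (@Fin.snoc 3 (fun _ => UnitAddCircle) x s : UnitAddTorus (Fin 4)) = x :=
    fun x s => funext fun l => by simp only [slow, Fin.snoc_castSucc]
  simp only [hsl]
  rw [integral_const, probReal_univ, one_smul]

/-! ## §3 The convection terms as total derivatives -/

section Convection

variable {j : Fin 3 → ℤ} {G : UnitAddTorus (Fin 3) → ℝ} {N : ℕ} {P : ℕ → UnitAddTorus (Fin 4) → EuclideanSpace ℝ (Fin 3)}

/-- **Leibniz, slow**: `∑ₗ (U)ₗ ∂_{xₗ} V = ∑ₗ ∂_{xₗ}((U)ₗ V) − (div_x U) V`. [folklore] -/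
theorem convect_slow_eq {U V : UnitAddTorus (Fin 4) → EuclideanSpace ℝ (Fin 3)} (hU : IsSmooth U) (hV : IsSmooth V)
    (y : UnitAddTorus (Fin 4)) :
    ∑ l : Fin 3, (U y) l • sDeriv l V y =
      (∑ l : Fin 3, sDeriv l (fun z => (U z) l • V z) y) - (∑ l : Fin 3, (sDeriv l U y) l) • V y := by
  have hU1 : IsContDiff 1 U := hU.isContDiff (by simp)
  have hV1 : IsContDiff 1 V := hV.isContDiff (by simp)
  have h : ∀ l : Fin 3, sDeriv l (fun z => (U z) l • V z) y = (U y) l • sDeriv l V y + (sDeriv l U y) l • V y := by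
    intro l
    simp only [sDeriv]
    rw [partialDeriv_smul ((Energy.isSmooth_coord hU l).isContDiff (by simp)) hV1, Energy.partialDeriv_apply_coord' hU1]
  simp only [h, Finset.sum_add_distrib, Finset.sum_smul]
  abel

/-- **Leibniz, fast**: `∑ₗ (U)ₗ kₗ∂_θ V = ∂_θ ((U·k) V) − (k·∂_θ U) V` (the weight `k = ∇G + j` has no fast
dependence). [folklore] -/
theorem convect_fast_eq (hG : IsSmooth G) {U V : UnitAddTorus (Fin 4) → EuclideanSpace ℝ (Fin 3)} (hU : IsSmooth U)
    (hV : IsSmooth V) (y : UnitAddTorus (Fin 4)) :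
    ∑ l : Fin 3, (U y) l • fDeriv j G l V y =
      partialDeriv (Fin.last 3) (fun z => (∑ l : Fin 3, (U z) l * phaseGrad j G l (slow z)) • V z) y
        - (∑ i : Fin 3, (fDeriv j G i U y) i) • V y := by
  have hπ : IsSmooth (fun z => ∑ l : Fin 3, (U z) l * phaseGrad j G l (slow z)) :=
    Energy.isSmooth_fsum Finset.univ fun l _ =>
      Energy.isSmooth_mul (Energy.isSmooth_coord hU l) (Energy.isSmooth_phaseGrad_slow j hG l)
  rw [partialDeriv_smul (hπ.isContDiff (by simp)) (hV.isContDiff (by simp)),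
    Energy.partialDeriv_last_sum_coord_mul_phaseGrad hG hU y, add_sub_cancel_right, Finset.sum_smul]
  exact Finset.sum_congr rfl fun l _ => by rw [fDeriv, smul_smul]

/-- **The divergence bookkeeping**: for every `b`, the non-derivative factors produced by the Leibniz rule add up to
the formal divergence `divCoeff … (s − b)` (or to nothing), hence vanish under `d_{s'} ≡ 0 (s' ≤ N + 1)`. [folklore] -/
theorem sum_div_indicator_eq_zero (hdiv : ∀ s, s ≤ N + 1 → ∀ y, divCoeff j G N P s y = 0) (s b : ℕ)
    (y : UnitAddTorus (Fin 4)) :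
    (∑ a ∈ Finset.range (N + 1), ((if a + b + 1 = s then ∑ i : Fin 3, (sDeriv i (P a) y) i else 0) +
      (if a + b = s then ∑ i : Fin 3, (fDeriv j G i (P a) y) i else 0))) = 0 := by
  by_cases h : b ≤ s ∧ s - b ≤ N + 1
  · refine Eq.trans ?_ (hdiv (s - b) h.2 y)
    unfold divCoeff
    refine Finset.sum_congr rfl fun a _ => ?_
    congr 1
    · by_cases hc : a + b + 1 = s
      · rw [if_pos hc, if_pos (by omega)]
      · rw [if_neg hc, if_neg (by omega)]
    · by_cases hc : a + b = s
      · rw [if_pos hc, if_pos (by omega)]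
      · rw [if_neg hc, if_neg (by omega)]
  · exact Finset.sum_eq_zero fun a ha => by
      have ha' := Finset.mem_range.1 ha
      rw [if_neg (by omega), if_neg (by omega), add_zero]

/-- **The convection sum is a sum of total derivatives** once the formal divergence vanishes to order `N + 1`. [folklore] -/
theorem conv_eq_totalDeriv (hG : IsSmooth G) (hP : ∀ a, IsSmooth (P a))
    (hdiv : ∀ s, s ≤ N + 1 → ∀ y, divCoeff j G N P s y = 0) (s : ℕ) (y : UnitAddTorus (Fin 4)) :
    (∑ a ∈ Finset.range (N + 1), ∑ b ∈ Finset.range (N + 1),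
      ((if a + b + 1 = s then ∑ l : Fin 3, (P a y) l • sDeriv l (P b) y else 0) +
        (if a + b = s then ∑ l : Fin 3, (P a y) l • fDeriv j G l (P b) y else 0))) =
    ∑ a ∈ Finset.range (N + 1), ∑ b ∈ Finset.range (N + 1),
      ((if a + b + 1 = s then ∑ l : Fin 3, sDeriv l (fun z => (P a z) l • P b z) y else 0) +
        (if a + b = s then
          partialDeriv (Fin.last 3) (fun z => (∑ l : Fin 3, (P a z) l * phaseGrad j G l (slow z)) • P b z) y else 0)) := by
  have hterm : ∀ a b : ℕ,
      ((if a + b + 1 = s then ∑ l : Fin 3, (P a y) l • sDeriv l (P b) y else 0) +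
        (if a + b = s then ∑ l : Fin 3, (P a y) l • fDeriv j G l (P b) y else 0)) =
      ((if a + b + 1 = s then ∑ l : Fin 3, sDeriv l (fun z => (P a z) l • P b z) y else 0) +
        (if a + b = s then
          partialDeriv (Fin.last 3) (fun z => (∑ l : Fin 3, (P a z) l * phaseGrad j G l (slow z)) • P b z) y else 0))
      - ((if a + b + 1 = s then ∑ i : Fin 3, (sDeriv i (P a) y) i else 0) +
          (if a + b = s then ∑ i : Fin 3, (fDeriv j G i (P a) y) i else 0)) • P b y := by
    intro a b
    have h1 : (if a + b + 1 = s then ∑ l : Fin 3, (P a y) l • sDeriv l (P b) y else 0) =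
        (if a + b + 1 = s then ∑ l : Fin 3, sDeriv l (fun z => (P a z) l • P b z) y else 0)
          - (if a + b + 1 = s then ∑ i : Fin 3, (sDeriv i (P a) y) i else 0) • P b y := by
      by_cases hc : a + b + 1 = s
      · simp only [if_pos hc]
        exact convect_slow_eq (hP a) (hP b) y
      · simp only [if_neg hc, zero_smul, sub_zero]
    have h2 : (if a + b = s then ∑ l : Fin 3, (P a y) l • fDeriv j G l (P b) y else 0) =
        (if a + b = s then
          partialDeriv (Fin.last 3) (fun z => (∑ l : Fin 3, (P a z) l * phaseGrad j G l (slow z)) • P b z) y else 0)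
          - (if a + b = s then ∑ i : Fin 3, (fDeriv j G i (P a) y) i else 0) • P b y := by
      by_cases hc : a + b = s
      · simp only [if_pos hc]
        exact convect_fast_eq hG (hP a) (hP b) y
      · simp only [if_neg hc, zero_smul, sub_zero]
    rw [h1, h2, add_smul]
    abel
  rw [Finset.sum_congr rfl fun a _ => Finset.sum_congr rfl fun b _ => hterm a b]
  simp only [Finset.sum_sub_distrib]
  rw [sub_eq_self, Finset.sum_comm]
  refine Finset.sum_eq_zero fun b _ => ?_
  rw [← Finset.sum_smul, sum_div_indicator_eq_zero hdiv s b y, zero_smul]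

end Convection

/-! ## §4 The registered tools sub-stub -/

/-- **stub_hierarchyWMomentum** (registered tools sub-stub of stmt-AnomalousDissipation-16293): the formal momentum
identity — for smooth data with `∫_{T³} f = 0` and formal divergence vanishing to order `N + 1`, every coefficient
profile `hierarchyCoeff … s` of the ε-free steady residual has zero mean over `T⁴`. [folklore] -/
theorem stub_hierarchyWMomentum : ∀ (j : Fin 3 → ℤ) (G : UnitAddTorus (Fin 3) → ℝ) (f : UnitAddTorus (Fin 3) → EuclideanSpace ℝ (Fin 3)) (N : ℕ) (P : ℕ → UnitAddTorus (Fin 4) → EuclideanSpace ℝ (Fin 3)) (Q : ℕ → UnitAddTorus (Fin 4) → ℝ) (c : ℕ → ℝ), Literature.Analysis.FunctionSpaces.Torus.IsSmooth G → Literature.Analysis.FunctionSpaces.Torus.IsSmooth f → (∀ a, Literature.Analysis.FunctionSpaces.Torus.IsSmooth (P a)) → (∀ a, Literature.Analysis.FunctionSpaces.Torus.IsSmooth (Q a)) → Literature.Analysis.FunctionSpaces.Torus.HasZeroMean f → (∀ s, s ≤ N + 1 → ∀ y, divCoeff j G N P s y = 0) → ∀ s : ℕ, ∫ y, hierarchyCoeff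 j G f N P Q c s y = 0 := by
  intro j G f N P Q c hG hf hP hQ hf0 hdiv s
  -- the fast momenta `π_a = P_a · k` are smooth
  have hπ : ∀ a, IsSmooth (fun z : UnitAddTorus (Fin 4) => ∑ l : Fin 3, (P a z) l * phaseGrad j G l (slow z)) :=
    fun a => Energy.isSmooth_fsum Finset.univ fun l _ =>
      Energy.isSmooth_mul (Energy.isSmooth_coord (hP a) l) (Energy.isSmooth_phaseGrad_slow j hG l)
  -- pointwise: the coefficient profile with its convection sum rewritten as total derivatives
  have key : ∀ y, hierarchyCoeff j G f N P Q c s y =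
      (∑ a ∈ Finset.range (N + 1), ∑ b ∈ Finset.range (N + 1),
        ((if a + b + 1 = s then ∑ l : Fin 3, sDeriv l (fun z => (P a z) l • P b z) y else 0) +
          (if a + b = s then
            partialDeriv (Fin.last 3) (fun z => (∑ l : Fin 3, (P a z) l * phaseGrad j G l (slow z)) • P b z) y
            else 0)))
      - (∑ a ∈ Finset.range (N + 1),
          ((if a + 3 = s then ∑ i : Fin 3, sDeriv i (sDeriv i (P a)) y else 0) +
            (if a + 2 = s then ∑ i : Fin 3, (sDeriv i (fDeriv j G i (P a)) y + fDeriv j G i (sDeriv i (P a)) y)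
              else 0) +
            (if a + 1 = s then ∑ i : Fin 3, fDeriv j G i (fDeriv j G i (P a)) y else 0)))
      + (∑ a ∈ Finset.range (N + 1),
          WithLp.toLp 2 (fun i : Fin 3 =>
            (if a + 1 = s then sDeriv i (Q a) y else 0) + (if a = s then fDeriv j G i (Q a) y else 0)))
      - (∑ a ∈ Finset.range (N + 1), ∑ b ∈ Finset.range (N + 1),
          ((if a + b + 1 = s then c a • sDeriv 2 (P b) y else 0) +
            (if a + b = s then c a • fDeriv j G 2 (P b) y else 0)))
      - (if s = 1 then f (slow y) else 0) := by
    intro y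
    unfold hierarchyCoeff
    rw [conv_eq_totalDeriv hG hP hdiv s y]
  rw [integral_congr_ae (ae_of_all _ key)]
  -- every piece is integrable of zero mean
  have hconv : Integrable (fun y => ∑ a ∈ Finset.range (N + 1), ∑ b ∈ Finset.range (N + 1),
        ((if a + b + 1 = s then ∑ l : Fin 3, sDeriv l (fun z => (P a z) l • P b z) y else 0) +
          (if a + b = s then
            partialDeriv (Fin.last 3) (fun z => (∑ l : Fin 3, (P a z) l * phaseGrad j G l (slow z)) • P b z) y
            else 0))) ∧
      ∫ y, (∑ a ∈ Finset.range (N + 1), ∑ b ∈ Finset.range (N + 1),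
        ((if a + b + 1 = s then ∑ l : Fin 3, sDeriv l (fun z => (P a z) l • P b z) y else 0) +
          (if a + b = s then
            partialDeriv (Fin.last 3) (fun z => (∑ l : Fin 3, (P a z) l * phaseGrad j G l (slow z)) • P b z) y
            else 0))) = 0 :=
    nm_sum _ fun a _ => nm_sum _ fun b _ =>
      nm_add (nm_ite _ (nm_sum _ fun l _ => nm_sDeriv ((Energy.isSmooth_coord (hP a) l).smul' (hP b)) l))
        (nm_ite _ (nm_partialDeriv ((hπ a).smul' (hP b)) (Fin.last 3)))
  have hvisc : Integrable (fun y => ∑ a ∈ Finset.range (N + 1),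
        ((if a + 3 = s then ∑ i : Fin 3, sDeriv i (sDeriv i (P a)) y else 0) +
          (if a + 2 = s then ∑ i : Fin 3, (sDeriv i (fDeriv j G i (P a)) y + fDeriv j G i (sDeriv i (P a)) y)
            else 0) +
          (if a + 1 = s then ∑ i : Fin 3, fDeriv j G i (fDeriv j G i (P a)) y else 0))) ∧
      ∫ y, (∑ a ∈ Finset.range (N + 1),
        ((if a + 3 = s then ∑ i : Fin 3, sDeriv i (sDeriv i (P a)) y else 0) +
          (if a + 2 = s then ∑ i : Fin 3, (sDeriv i (fDeriv j G i (P a)) y + fDeriv j G i (sDeriv i (P a)) y)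
            else 0) +
          (if a + 1 = s then ∑ i : Fin 3, fDeriv j G i (fDeriv j G i (P a)) y else 0))) = 0 :=
    nm_sum _ fun a _ =>
      nm_add (nm_add (nm_ite _ (nm_sum _ fun i _ => nm_sDeriv (FormalExpansion.isSmooth_sDeriv (hP a) i) i))
        (nm_ite _ (nm_sum _ fun i _ => nm_add (nm_sDeriv (FormalExpansion.isSmooth_fDeriv j hG i (hP a)) i)
          (nm_fDeriv j hG i (FormalExpansion.isSmooth_sDeriv (hP a) i)))))
        (nm_ite _ (nm_sum _ fun i _ => nm_fDeriv j hG i (FormalExpansion.isSmooth_fDeriv j hG i (hP a))))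
  have hpres : Integrable (fun y => ∑ a ∈ Finset.range (N + 1),
        (WithLp.toLp 2 (fun i : Fin 3 =>
          (if a + 1 = s then sDeriv i (Q a) y else 0) + (if a = s then fDeriv j G i (Q a) y else 0)) :
            EuclideanSpace ℝ (Fin 3))) ∧
      ∫ y, (∑ a ∈ Finset.range (N + 1),
        (WithLp.toLp 2 (fun i : Fin 3 =>
          (if a + 1 = s then sDeriv i (Q a) y else 0) + (if a = s then fDeriv j G i (Q a) y else 0)) :
            EuclideanSpace ℝ (Fin 3))) = 0 :=
    nm_sum _ fun a _ =>
      nm_toLp (g := fun i y => (if a + 1 = s then sDeriv i (Q a) y else 0) + (if a = s then fDeriv j G i (Q a) y else 0))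
        fun i => nm_add (nm_ite _ (nm_sDeriv (hQ a) i)) (nm_ite _ (nm_fDeriv j hG i (hQ a)))
  have hdrift : Integrable (fun y => ∑ a ∈ Finset.range (N + 1), ∑ b ∈ Finset.range (N + 1),
        ((if a + b + 1 = s then c a • sDeriv 2 (P b) y else 0) +
          (if a + b = s then c a • fDeriv j G 2 (P b) y else 0))) ∧
      ∫ y, (∑ a ∈ Finset.range (N + 1), ∑ b ∈ Finset.range (N + 1),
        ((if a + b + 1 = s then c a • sDeriv 2 (P b) y else 0) +
          (if a + b = s then c a • fDeriv j G 2 (P b) y else 0))) = 0 :=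
    nm_sum _ fun a _ => nm_sum _ fun b _ =>
      nm_add (nm_ite _ (nm_smul (c a) (nm_sDeriv (hP b) 2))) (nm_ite _ (nm_smul (c a) (nm_fDeriv j hG 2 (hP b))))
  have hforce : Integrable (fun y : UnitAddTorus (Fin 4) => if s = 1 then f (slow y) else 0) ∧
      ∫ y : UnitAddTorus (Fin 4), (if s = 1 then f (slow y) else 0) = 0 :=
    nm_ite _ ⟨(ResidualTransfer.isSmooth_comp_slow hf).integrable, by
      rw [integral_comp_slow hf.continuous]
      exact hf0⟩
  exact (nm_sub (nm_sub (nm_add (nm_sub hconv hvisc) hpres) hdrift) hforce).2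

end Summit.AnomalousDissipation.AnomalousDissipation.Theorems.TaylorWaveQuasiSteady.Momentum

end
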